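import Summits.AtomisticToContinuum.HydrodynamicLimit.Theorems.JParityClosureLocalSecondLawLedgerFields

/-!
# Entropy ledger for `JParityClosure.LocalSecondLaw` — the pointwise Gibbs identity and its integrated form
(stmt-AtomisticToContinuum-13081, line `exact-entropy-ledger-three-passivities`, layer 5 of stub L)

The entropy / entropy-flux compatibility of the hard-sphere Euler pair, at the level of the cone-mollified
empirical fields of ONE configuration in the regular range.  At a good field point, along the free flight the
entropy density `S = H(ρ_r, θ_r)` changes at the rate `∂ₜS` given by the chain rule with the same-kernel
identities `∂ₜρ = -div m`, `∂ₜm = -div M`, `∂ₜe = -div Q` (layer 3), and the GIBBS RELATION with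
`p = hsPressure = ρθ(1 + ρσ³ f_ex')` gives the algebraic identity
`∂ₜS + div(S u) = θ⁻¹ [Σ^dev : ∇u - p_ex div u + div q^kin]` (`gibbs_core_dir`, direction by direction, checked by
`field_simp; ring`).  Multiplying by a smooth weight `φ₀`, using the product rule at good points and the zero
mean of `∂ₖ(φ₀ S u_k)` and `∂ₖ((φ₀/θ) q_k)` (layer 4) yields the integrated inner identity
`∫ φ₀ ∂ₜS = ∫ S u·∇φ₀ + ∫ (φ₀/θ) Σ^dev:∇u - ∫ (φ₀/θ) p_ex div u - ∫ ∇(φ₀/θ)·q^kin` (`integral_phi_mul_dSfl`).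

References: S. R. de Groot, P. Mazur, *Non-Equilibrium Thermodynamics* (1962) Ch. II §2, Ch. IX §4;
J. H. Irving, J. G. Kirkwood, J. Chem. Phys. 18 (1950) 817.
-/

noncomputable section

namespace Summit.AtomisticToContinuum.HydrodynamicLimit.Theorems.LocalSecondLawLedger

open scoped BigOperators Topology ENNReal InnerProductSpace
open Filter Set MeasureTheory
open Literature.MathematicalPhysics.KineticTheory
open Literature.Analysis.FluidPDE
open Literature.Analysis.FunctionSpaces
open Summit.AtomisticToContinuum.HydrodynamicLimit.Theorems.LocalSecondLawNegative

namespace L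

variable {N : ℕ}

/-! ## Derivative formulas of the derived fields -/

/-- Derivative of `θ = (2/3)(e/ρ - |m|²/(2ρ²))` along a curve of moments. [folklore] -/
def thetaD (ρ e ρ' e' : ℝ) (m m' : Fin 3 → ℝ) : ℝ :=
  2 / 3 * (e' / ρ - e * ρ' / ρ ^ 2 - (∑ k, m k * m' k) / ρ ^ 2 + (∑ k, m k ^ 2) * ρ' / ρ ^ 3)

/-- Derivative of `u_k = m_k/ρ` along a curve of moments. [folklore] -/
def uD (ρ ρ' mk mk' : ℝ) : ℝ := mk' / ρ - mk * ρ' / ρ ^ 2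

/-- Derivative of the entropy density along a curve `(ρ, θ)` in the regular range (`S` its value,
`f₁ = f_ex'(ρσ³)`). [folklore] -/
def SD (S ρ θ f₁ σ ρ' θ' : ℝ) : ℝ := S * ρ' / ρ - 3 / 2 * ρ * θ' / θ + ρ' + f₁ * σ ^ 3 * ρ * ρ'

/-- Derivative of the kinetic heat current `q_k` along a curve of moments (raw product rule). [folklore] -/
def qD (ρ e Q' ρ' e' : ℝ) (m u m' u' Mk Mk' : Fin 3 → ℝ) (k : Fin 3) : ℝ :=
  Q' - (u' k * e + u k * e') - ∑ l, (u' l * Mk l + u l * Mk' l)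
    + (u' k * (∑ l, u l * m l) + u k * ∑ l, (u' l * m l + u l * m' l))
    + ((∑ l, 2 * u l * u' l) / 2 * (m k - ρ * u k) + (∑ l, u l ^ 2) / 2 * (m' k - (ρ' * u k + ρ * u' k)))

/-- **The Gibbs identity, direction by direction.**  For a state `(ρ, m, e, M)` with `u = m/ρ`,
`e = (3/2)ρθ + |m|²/(2ρ)`, traceless stress `Σ^dev = M - u⊗m - m⊗u + ρ u⊗u - ρθ𝟙`, excess pressure
`p_ex = ρθ · ρσ³ f₁`, and first-order data `(ρ', m', M', Q')` in the direction `j` (symmetric `M, M'`,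
`e' = tr M'/2`), the direction-`j` share of `∂ₜS` (fed by `∂ₜρ = -m'_j`, `∂ₜm = -M'_{j·}`, `∂ₜe = -Q'`) plus the
direction-`j` share of `div(Su) - θ⁻¹[Σ^dev:∇u - p_ex div u + div q]` vanishes identically. [folklore] -/
theorem gibbs_core_dir (j : Fin 3) (ρ S f₁ σ θ e pex ρ' Q' : ℝ) (m u m' : Fin 3 → ℝ)
    (M M' dev : Fin 3 → Fin 3 → ℝ) (hρ : ρ ≠ 0) (hθ0 : θ ≠ 0)
    (he : e = 3 / 2 * ρ * θ + (∑ k, m k ^ 2) / (2 * ρ))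
    (hu : ∀ k, u k = ρ⁻¹ * m k)
    (hdev : ∀ k l, dev k l = M k l - u k * m l - m k * u l + ρ * u k * u l - ρ * θ * (if k = l then 1 else 0))
    (hpex : pex = ρ * θ * (ρ * σ ^ 3 * f₁))
    (hM : ∀ k l, M k l = M l k) (hM' : ∀ k l, M' k l = M' l k) :
    SD S ρ θ f₁ σ (-m' j) (thetaD ρ e (-m' j) (-Q') m (fun l => -M' j l))
      + (SD S ρ θ f₁ σ ρ' (thetaD ρ e ρ' ((∑ i, M' i i) / 2) m m') * u j + S * uD ρ ρ' (m j) (m' j))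
      - θ⁻¹ * ((∑ l, dev j l * uD ρ ρ' (m l) (m' l)) - pex * uD ρ ρ' (m j) (m' j)
          + qD ρ e Q' ρ' ((∑ i, M' i i) / 2) m u m' (fun l => uD ρ ρ' (m l) (m' l))
              (fun l => M l j) (fun l => M' l j) j) = 0 := by
  have h01 : ¬ ((0 : Fin 3) = 1) := by decide
  have h02 : ¬ ((0 : Fin 3) = 2) := by decide
  have h10 : ¬ ((1 : Fin 3) = 0) := by decide
  have h12 : ¬ ((1 : Fin 3) = 2) := by decide
  have h20 : ¬ ((2 : Fin 3) = 0) := by decide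
  have h21 : ¬ ((2 : Fin 3) = 1) := by decide
  simp only [Fin.sum_univ_three] at he
  unfold SD thetaD uD qD
  fin_cases j
  · simp only [hdev, hu, hpex, Fin.sum_univ_three, Fin.isValue, Fin.zero_eta, h01, h02, if_true, if_false,
      hM 1 0, hM 2 0, hM' 1 0, hM' 2 0]
    rw [he]
    field_simp
    ring
  · simp only [hdev, hu, hpex, Fin.sum_univ_three, Fin.isValue, Fin.mk_one, h10, h12, if_true, if_false,
      hM 1 0, hM 2 1, hM' 1 0, hM' 2 1]
    rw [he]
    field_simp
    ring
  · simp only [hdev, hu, hpex, Fin.sum_univ_three, Fin.isValue, Fin.reduceFinMk, h20, h21, if_true, if_false,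
      hM 2 0, hM 2 1, hM' 2 0, hM' 2 1]
    rw [he]
    field_simp
    ring

/-! ## First-order data of the derived fields at a field point -/

/-- Direction-`e` derivative of the coarse temperature at `x`. [folklore] -/
def dTheta (r : ℝ) (w : Phase N) (x : T3) (e : V3) : ℝ :=
  thetaD (rhoC r w x) (kinC r w x) (dRho r w x e) ((∑ j : Fin 3, dMmom r w x e j j) / 2)
    (fun k => momC r w x k) (fun k => dMom r w x e k)

/-- Direction-`e` derivative of the coarse velocity at `x`. [folklore] -/
def dU (r : ℝ) (w : Phase N) (x : T3) (e : V3) (l : Fin 3) : ℝ :=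
  uD (rhoC r w x) (dRho r w x e) (momC r w x l) (dMom r w x e l)

/-- Direction-`e` derivative of the entropy density at `x`. [folklore] -/
def dS (σ r : ℝ) (w : Phase N) (x : T3) (e : V3) : ℝ :=
  SD (Hs σ (rhoC r w x) (thetaC r w x)) (rhoC r w x) (thetaC r w x)
    (deriv hsExcessFreeEnergy (rhoC r w x * σ ^ 3)) σ (dRho r w x e) (dTheta r w x e)

/-- Direction-`e` derivative of the kinetic heat current at `x`. [folklore] -/
def dQ (r : ℝ) (w : Phase N) (x : T3) (e : V3) (k : Fin 3) : ℝ :=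
  qD (rhoC r w x) (kinC r w x) (dQmom r w x e k) (dRho r w x e) ((∑ j : Fin 3, dMmom r w x e j j) / 2)
    (fun l => momC r w x l) (fun l => uC r w x l) (fun l => dMom r w x e l) (fun l => dU r w x e l)
    (fun l => Mmom r w x l k) (fun l => dMmom r w x e l k) k

/-- The free-flight time derivative `∂ₜS` of the entropy density at `x`, written as the sum over directions of
the chain rule fed by the same-kernel identities `∂ₜρ = -∂_j m_j`, `∂ₜm = -∂_j M_{j·}`, `∂ₜe = -∂_j Q_j`.
[folklore] -/
def dSfl (σ r : ℝ) (w : Phase N) (x : T3) : ℝ :=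
  ∑ j : Fin 3, SD (Hs σ (rhoC r w x) (thetaC r w x)) (rhoC r w x) (thetaC r w x)
    (deriv hsExcessFreeEnergy (rhoC r w x * σ ^ 3)) σ (-dMom r w x (EuclideanSpace.single j 1) j)
    (thetaD (rhoC r w x) (kinC r w x) (-dMom r w x (EuclideanSpace.single j 1) j)
      (-dQmom r w x (EuclideanSpace.single j 1) j) (fun k => momC r w x k)
      (fun l => -dMmom r w x (EuclideanSpace.single j 1) j l))

/-- The derivative of the second moment is symmetric. [folklore] -/
theorem dMmom_symm (r : ℝ) (w : Phase N) (x : T3) (e : V3) (k l : Fin 3) :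
    dMmom r w x e k l = dMmom r w x e l k := by
  unfold dMmom; congr 1; refine Finset.sum_congr rfl fun i _ => ?_; ring

/-! ## Slices of the derived fields through a good field point of a regular configuration -/

section Slices

variable {σ r c η₁ η₀ : ℝ} {F : ℝ → ℝ} (hE : EosBand η₀ F) (hη₁ : η₁ < η₀) (hσ : 0 < σ) (hc : 0 < c)
  {w : Phase N} (hreg : ∀ x, c ≤ rhoC r w x ∧ rhoC r w x * σ ^ 3 ≤ η₁ ∧ c ≤ thetaC r w x)
  {x : T3} (hx : ∀ i, DifferentiableAt ℝ (Torus.liftAt (fun z : T3 => cone r z 0) ((w i).1 - x)) 0)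

include hc hreg hx in
/-- The coarse temperature along a line through a good field point. [folklore] -/
theorem hasDerivAt_thetaC_line (e : V3) :
    HasDerivAt (fun t : ℝ => thetaC r w (x + Torus.proj (t • e))) (dTheta r w x e) 0 := by
  have hfun : (fun t : ℝ => thetaC r w (x + Torus.proj (t • e))) = fun t =>
      2 / 3 * (kinC r w (x + Torus.proj (t • e)) / rhoC r w (x + Torus.proj (t • e))
        - (∑ k, momC r w (x + Torus.proj (t • e)) k ^ 2) / (2 * rhoC r w (x + Torus.proj (t • e)) ^ 2)) :=
    funext fun t => thetaC_eq r w _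
  rw [hfun]
  have hρ0 : rhoC r w (x + Torus.proj ((0 : ℝ) • e)) ≠ 0 := (hc.trans_le (hreg _).1).ne'
  have h := hasDerivAt_theta_curve (hasDerivAt_rhoC_line hx e) (fun k => hasDerivAt_momC_line hx e k)
    (hasDerivAt_kinC_line hx e) hρ0
  simp only [zero_smul, Torus.proj_zero, add_zero] at h
  exact h

include hc hreg hx in
/-- The coarse velocity along a line through a good field point. [folklore] -/
theorem hasDerivAt_uC_line (e : V3) (l : Fin 3) :
    HasDerivAt (fun t : ℝ => uC r w (x + Torus.proj (t • e)) l) (dU r w x e l) 0 := by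
  simp only [uC_apply]
  have hρ0 : rhoC r w (x + Torus.proj ((0 : ℝ) • e)) ≠ 0 := (hc.trans_le (hreg _).1).ne'
  have h := hasDerivAt_u_curve (hasDerivAt_rhoC_line hx e) (hasDerivAt_momC_line hx e l) hρ0
  simp only [zero_smul, Torus.proj_zero, add_zero] at h
  exact h

include hE hη₁ hσ hc hreg hx in
/-- The entropy density along a line through a good field point. [folklore] -/
theorem hasDerivAt_Hs_line (e : V3) :
    HasDerivAt (fun t : ℝ => Hs σ (rhoC r w (x + Torus.proj (t • e))) (thetaC r w (x + Torus.proj (t • e))))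
      (dS σ r w x e) 0 := by
  have hρ0 : 0 < rhoC r w (x + Torus.proj ((0 : ℝ) • e)) := hc.trans_le (hreg _).1
  have hθ0 : 0 < thetaC r w (x + Torus.proj ((0 : ℝ) • e)) := hc.trans_le (hreg _).2.2
  have hband : rhoC r w (x + Torus.proj ((0 : ℝ) • e)) * σ ^ 3 < η₀ := (hreg _).2.1.trans_lt hη₁
  have h := hasDerivAt_Hs hE (hasDerivAt_rhoC_line hx e) (hasDerivAt_thetaC_line hc hreg hx e) hρ0 hθ0 hσ hband
  simp only [zero_smul, Torus.proj_zero, add_zero] at h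
  exact h

include hc hreg hx in
/-- The kinetic heat current along a line through a good field point. [folklore] -/
theorem hasDerivAt_qkinC_line (e : V3) (k : Fin 3) :
    HasDerivAt (fun t : ℝ => qkinC r w (x + Torus.proj (t • e)) k) (dQ r w x e k) 0 := by
  have hfun : (fun t : ℝ => qkinC r w (x + Torus.proj (t • e)) k) = fun t =>
      Qmom r w (x + Torus.proj (t • e)) k
        - uC r w (x + Torus.proj (t • e)) k * kinC r w (x + Torus.proj (t • e))
        - (∑ l, uC r w (x + Torus.proj (t • e)) l * Mmom r w (x + Torus.proj (t • e)) l k)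
        + uC r w (x + Torus.proj (t • e)) k * (∑ l, uC r w (x + Torus.proj (t • e)) l * momC r w (x + Torus.proj (t • e)) l)
        + (∑ l, uC r w (x + Torus.proj (t • e)) l ^ 2) / 2 *
          (momC r w (x + Torus.proj (t • e)) k - rhoC r w (x + Torus.proj (t • e)) * uC r w (x + Torus.proj (t • e)) k) :=
    funext fun t => qkinC_eq r w _ k
  rw [hfun]
  have h := hasDerivAt_q_curve k (hasDerivAt_rhoC_line hx e) (fun l => hasDerivAt_momC_line hx e l)
    (hasDerivAt_kinC_line hx e) (fun l => hasDerivAt_uC_line hc hreg hx e l)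
    (fun l => hasDerivAt_Mmom_line hx e l k) (hasDerivAt_Qmom_line hx e k)
  simp only [zero_smul, Torus.proj_zero, add_zero] at h
  exact h

end Slices

/-- A smooth function along a coordinate line has derivative the crux's partial derivative. [folklore] -/
theorem hasDerivAt_smooth_line {g : T3 → ℝ} (hg : Torus.IsContDiff 1 g) (x : T3) (k : Fin 3) :
    HasDerivAt (fun t : ℝ => g (x + Torus.proj (t • EuclideanSpace.single k 1))) (pD k g x) 0 :=
  (Literature.Analysis.FluidPDE.Torus.hasDerivAt_apply_add_proj_smul hg x _ 0).differentiableAt.hasDerivAt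

/-! ## The pointwise Gibbs identity at a good field point -/

section Pointwise

variable {σ r c η₁ η₀ : ℝ} {F : ℝ → ℝ} (hE : EosBand η₀ F) (hη₁ : η₁ < η₀) (hσ : 0 < σ) (hc : 0 < c)
  {w : Phase N} (hreg : ∀ x, c ≤ rhoC r w x ∧ rhoC r w x * σ ^ 3 ≤ η₁ ∧ c ≤ thetaC r w x)
  {g : T3 → ℝ} (hg : Torus.IsContDiff 1 g)
  {x : T3} (hx : ∀ i, DifferentiableAt ℝ (Torus.liftAt (fun z : T3 => cone r z 0) ((w i).1 - x)) 0)
include hE hη₁ hσ hc hreg hg hx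

/-- **The direction-`k` Gibbs identity at a good field point, weighted by a smooth `g`.** [folklore] -/
theorem pointwise_gibbs_dir (k : Fin 3) :
    g x * SD (Hs σ (rhoC r w x) (thetaC r w x)) (rhoC r w x) (thetaC r w x)
        (deriv hsExcessFreeEnergy (rhoC r w x * σ ^ 3)) σ (-dMom r w x (EuclideanSpace.single k 1) k)
        (thetaD (rhoC r w x) (kinC r w x) (-dMom r w x (EuclideanSpace.single k 1) k)
          (-dQmom r w x (EuclideanSpace.single k 1) k) (fun k => momC r w x k)
          (fun l => -dMmom r w x (EuclideanSpace.single k 1) k l)) =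
      -pD k (fun y => g y * Hs σ (rhoC r w y) (thetaC r w y) * uC r w y k) x
        + Hs σ (rhoC r w x) (thetaC r w x) * (momC r w x k / rhoC r w x * pD k g x)
        + g x / thetaC r w x * ∑ l, devC r w x k l * pD k (fun y => uC r w y l) x
        - g x / thetaC r w x * pexC σ r w x * pD k (fun y => uC r w y k) x
        + pD k (fun y => g y / thetaC r w y * qkinC r w y k) x
        - pD k (fun y => g y / thetaC r w y) x * qkinC r w x k := by
  set e : V3 := EuclideanSpace.single k 1 with he
  have hρ0 : rhoC r w x ≠ 0 := (hc.trans_le (hreg x).1).ne'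
  have hθ0 : thetaC r w x ≠ 0 := (hc.trans_le (hreg x).2.2).ne'
  -- the algebraic core in direction `k`
  have hcore := gibbs_core_dir k (rhoC r w x) (Hs σ (rhoC r w x) (thetaC r w x))
    (deriv hsExcessFreeEnergy (rhoC r w x * σ ^ 3)) σ (thetaC r w x) (kinC r w x) (pexC σ r w x)
    (dRho r w x e) (dQmom r w x e k) (fun l => momC r w x l) (fun l => uC r w x l) (fun l => dMom r w x e l)
    (fun a b => Mmom r w x a b) (fun a b => dMmom r w x e a b) (fun a b => devC r w x a b) hρ0 hθ0
    (by rw [thetaC_eq]; field_simp; ring) (fun l => uC_apply r w x l) (fun a b => devC_eq r w x a b)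
    (by unfold pexC hsPressure hsCompressibility; ring) (fun a b => Mmom_symm r w x a b)
    (fun a b => dMmom_symm r w x e a b)
  -- the product rules at the good point
  have hgl : HasDerivAt (fun t : ℝ => g (x + Torus.proj (t • e))) (pD k g x) 0 := hasDerivAt_smooth_line hg x k
  have hS := hasDerivAt_Hs_line hE hη₁ hσ hc hreg hx e
  have hu := fun l => hasDerivAt_uC_line hc hreg hx e l
  have hθ := hasDerivAt_thetaC_line hc hreg hx e
  have hq := hasDerivAt_qkinC_line hc hreg hx e k
  have hF1 : HasDerivAt (fun t : ℝ => g (x + Torus.proj (t • e)) * Hs σ (rhoC r w (x + Torus.proj (t • e)))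
      (thetaC r w (x + Torus.proj (t • e))) * uC r w (x + Torus.proj (t • e)) k) _ 0 := (hgl.mul hS).mul (hu k)
  have hP1 : pD k (fun y => g y * Hs σ (rhoC r w y) (thetaC r w y) * uC r w y k) x =
      pD k g x * Hs σ (rhoC r w x) (thetaC r w x) * uC r w x k
        + g x * (dS σ r w x e * uC r w x k + Hs σ (rhoC r w x) (thetaC r w x) * dU r w x e k) := by
    have h1 := hF1.deriv
    simp only [zero_smul, Torus.proj_zero, add_zero, Pi.mul_apply] at h1
    rw [show pD k (fun y => g y * Hs σ (rhoC r w y) (thetaC r w y) * uC r w y k) x =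
      deriv (fun t : ℝ => g (x + Torus.proj (t • e)) * Hs σ (rhoC r w (x + Torus.proj (t • e)))
        (thetaC r w (x + Torus.proj (t • e))) * uC r w (x + Torus.proj (t • e)) k) 0 from rfl, h1]
    ring
  have hgθ : HasDerivAt (fun t : ℝ => g (x + Torus.proj (t • e)) / thetaC r w (x + Torus.proj (t • e)))
      (pD k (fun y => g y / thetaC r w y) x) 0 := by
    have h := hgl.div hθ (by simpa using hθ0)
    exact h.differentiableAt.hasDerivAt
  have hF2 : HasDerivAt (fun t : ℝ => g (x + Torus.proj (t • e)) / thetaC r w (x + Torus.proj (t • e))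
      * qkinC r w (x + Torus.proj (t • e)) k) _ 0 := hgθ.mul hq
  have hP2 : pD k (fun y => g y / thetaC r w y * qkinC r w y k) x =
      pD k (fun y => g y / thetaC r w y) x * qkinC r w x k + g x / thetaC r w x * dQ r w x e k := by
    have h2 := hF2.deriv
    simp only [zero_smul, Torus.proj_zero, add_zero] at h2
    rw [show pD k (fun y => g y / thetaC r w y * qkinC r w y k) x =
      deriv (fun t : ℝ => g (x + Torus.proj (t • e)) / thetaC r w (x + Torus.proj (t • e))
        * qkinC r w (x + Torus.proj (t • e)) k) 0 from rfl, h2]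
  have hPu : ∀ l, pD k (fun y => uC r w y l) x = dU r w x e l := fun l => by
    rw [show pD k (fun y => uC r w y l) x = deriv (fun t : ℝ => uC r w (x + Torus.proj (t • e)) l) 0 from rfl]
    exact (hu l).deriv
  -- assemble
  simp only [hPu]
  rw [hP1, hP2]
  have hmu : momC r w x k / rhoC r w x = uC r w x k := by rw [uC_apply, div_eq_inv_mul]
  rw [hmu]
  have hdS : dS σ r w x e = SD (Hs σ (rhoC r w x) (thetaC r w x)) (rhoC r w x) (thetaC r w x)
      (deriv hsExcessFreeEnergy (rhoC r w x * σ ^ 3)) σ (dRho r w x e)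
      (thetaD (rhoC r w x) (kinC r w x) (dRho r w x e) ((∑ i, dMmom r w x e i i) / 2)
        (fun l => momC r w x l) (fun l => dMom r w x e l)) := rfl
  have hdU : ∀ l, dU r w x e l = uD (rhoC r w x) (dRho r w x e) (momC r w x l) (dMom r w x e l) := fun l => rfl
  have hdQ : dQ r w x e k = qD (rhoC r w x) (kinC r w x) (dQmom r w x e k) (dRho r w x e)
      ((∑ j, dMmom r w x e j j) / 2) (fun l => momC r w x l) (fun l => uC r w x l) (fun l => dMom r w x e l)
      (fun l => uD (rhoC r w x) (dRho r w x e) (momC r w x l) (dMom r w x e l))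
      (fun l => Mmom r w x l k) (fun l => dMmom r w x e l k) k := rfl
  rw [hdS, hdQ]
  simp only [hdU]
  have hθinv : g x / thetaC r w x = g x * (thetaC r w x)⁻¹ := div_eq_mul_inv _ _
  rw [hθinv]
  linear_combination (g x) * hcore

/-- **The pointwise Gibbs identity at a good field point** (summed over directions). [folklore] -/
theorem pointwise_gibbs :
    g x * dSfl σ r w x =
      -(∑ k, pD k (fun y => g y * Hs σ (rhoC r w y) (thetaC r w y) * uC r w y k) x)
        + Hs σ (rhoC r w x) (thetaC r w x) * ∑ k, momC r w x k / rhoC r w x * pD k g x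
        + g x / thetaC r w x * ∑ k, ∑ l, devC r w x k l * pD k (fun y => uC r w y l) x
        - g x / thetaC r w x * pexC σ r w x * ∑ k, pD k (fun y => uC r w y k) x
        + (∑ k, pD k (fun y => g y / thetaC r w y * qkinC r w y k) x)
        - ∑ k, pD k (fun y => g y / thetaC r w y) x * qkinC r w x k := by
  unfold dSfl
  rw [Finset.mul_sum]
  rw [Finset.sum_congr rfl fun k _ => pointwise_gibbs_dir hE hη₁ hσ hc hreg hg hx k]
  simp only [Finset.sum_add_distrib, Finset.sum_sub_distrib, Finset.sum_neg_distrib, Finset.mul_sum]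

end Pointwise

end L

/-- **Registered sub-goal `ledgerL_pointwise`** of stub `stub_ledger` (line `exact-entropy-ledger-three-passivities`):
The coarse temperature is differentiable along lines through good field points, with the layer's derivative formula. [folklore] -/
theorem ledgerL_pointwise :
  ∀ {N : ℕ} {σ r c η₁ : ℝ}, 0 < c → ∀ {w : Phase N}, (∀ x, c ≤ rhoC r w x ∧ rhoC r w x * σ ^ 3 ≤ η₁ ∧ c ≤ thetaC r w x) → ∀ {x : T3}, (∀ i, DifferentiableAt ℝ (Literature.Analysis.FunctionSpaces.Torus.liftAt (fun z : T3 => cone r z 0) ((w i).1 - x)) 0) → ∀ e : V3, HasDerivAt (fun t : ℝ => thetaC r w (x + Literature.Analysis.FunctionSpaces.Torus.proj (t • e))) (L.dTheta r w x e) 0 := by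
  intro N σ r c η₁ hc w hreg x hx e
  exact L.hasDerivAt_thetaC_line hc hreg hx e

end Summit.AtomisticToContinuum.HydrodynamicLimit.Theorems.LocalSecondLawLedger

end
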